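import Literature.MathematicalPhysics.QuantumLattice.DWaveSourceEnergyDensityCouplings
import Literature.MathematicalPhysics.QuantumLattice.DWaveSourceEnergyDensityCouplingTransport
import Mathlib.Analysis.Convex.Continuous
import Mathlib.Topology.Semicontinuity.Basic
import Mathlib.Topology.GDelta.Basic
import HarnessLib

/-!
# ORDER IS CLOSED, ABSENCE IS OPEN: the Koma–Tasaki `d`-wave order parameter of the `t–t'` Hubbard model is
# upper semicontinuous in the couplings `(t', U, μ)`; quantitative transport of ABSENT cells across `(U, μ)`

Topic `Literature/MathematicalPhysics/QuantumLattice` (namespace = path; family `hubbard`). Sequel of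
`DWaveSourceEnergyDensityCouplings.lean` (hubbard-cq-obsth-2: the thermodynamic-limit sourced ground-state
energy density `e_src(t',U,μ,h) = dWaveSourceEnergyDensityTT' t' U μ h` of the `d`-wave pair-sourced `t–t'`
Hubbard torus is JOINTLY CONCAVE on the coupling space `ℝ⁴`), `DWaveSourceEnergyDensityCouplingTransport.lean`
(obsth-2: `e_src` is non-increasing and `2`-Lipschitz in `μ`, non-decreasing and `1`-Lipschitz in `U`) and
`DWaveSourceNNNHoppingEnergyDensityExists.lean` (the cusp identity
`m⋆(t',U,μ) := dWaveOrderParameterTT' t' U μ = ⨅_{h>0} (e_src(t',U,μ,0) − e_src(t',U,μ,h))/(2h)`).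
Written for the Hubbard cuprate cell (`hubbard-cq`, rung CQ) and the phase-map format of the material-oracle
ladder (cells over coupling axes labelled PRESENT / ABSENT / undetermined): it says which cell shapes a
certificate CAN have. Everything is PROVED; no definition, no named fact, zero compute.

## Contents

* §1 `continuous_dWaveSourceEnergyDensityTT'_couplings` / `locallyLipschitz_…`: `e_src` is jointly continuous
  (indeed locally Lipschitz) on `ℝ⁴ = {(t', U, μ, h)}` — a finite concave function on an open set
  (Mathlib `ConcaveOn.locallyLipschitz`); one-variable corollaries in `t'`, `U`, `μ`, `h`.
* §2 **`upperSemicontinuous_dWaveOrderParameterTT'`: `(t', U, μ) ↦ m⋆(t',U,μ)` is UPPER SEMICONTINUOUS on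
  `ℝ³`** (an infimum over `h > 0` of the continuous secants `(e_src(·,0) − e_src(·,h))/(2h)`; this is
  Rockafellar's Cor. 24.5.1 — the one-sided directional derivative `f'(x; y)` of a finite convex `f` is u.s.c.
  in `x` — for `f = −e_src`, `x = (t',U,μ,0)`, `y = e_h`, since `m⋆ = −∂ₕ⁺e_src(·,0)/2`). Hence
  `isClosed_setOf_le_dWaveOrderParameterTT'`: every PRESENT cell `{(t',U,μ) : m₀ ≤ m⋆}` is CLOSED;
  `isOpen_setOf_dWaveOrderParameterTT'_lt`: every ABSENT cell `{m⋆ < m₀}` is OPEN; the orderless region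
  `{¬ HasDWaveOrderTT'}` is a `G_δ` (`isGδ_setOf_not_hasDWaveOrderTT'`); limits of coupling points carrying a
  UNIFORM floor keep the floor (`le_dWaveOrderParameterTT'_of_tendsto`), a uniform floor on a DENSE subset of an
  open coupling set holds on all of it (`le_dWaveOrderParameterTT'_of_dense`, `hasDWaveOrderTT'_of_dense_mu`);
  the `t' = 0` reading `upperSemicontinuous_dWaveOrderParameter` is literally the Prop `OrderParameterUSC`
  posited (not proved) in `Summits/HubbardSuperconductivity/…/Cruxes/FixedPointDWaveOrder/SketchIdeator1.lean`
  (card `generic-mu-concavity-closure`, (S4)), and `hasDWaveOrder_of_dense_uniform` is that sketch's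
  `order_of_dense_uniform` with the hypothesis discharged; (S2) there is `concaveOn_dWaveSourceEnergyDensity_couplings`.
* §3 QUANTITATIVE ABSENT TRANSPORT (the box-cell format): for every `h > 0` and all couplings,
  `m⋆(t',U',μ') ≤ (e_src(t',U,μ,0) − e_src(t',U,μ,h) + |U' − U| + 2|μ' − μ|)/(2h)`
  (`dWaveOrderParameterTT'_le_slope_add_of_couplings`; ONE-SIDED monotonicity in `U` and in `μ` is why the
  constants are the Lipschitz constants `1` and `2` once, not twice); with certified numbers
  `e_src(t',U,μ,0) ≤ hi₀`, `lo ≤ e_src(t',U,μ,h)` at ONE coupling point this is the ceiling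
  `m⋆(t',U',μ') ≤ (hi₀ − lo + |U' − U| + 2|μ' − μ|)/(2h)` on the WHOLE `(U', μ')`-plane
  (`dWaveOrderParameterTT'_le_of_windows_couplings`), i.e. an ABSENT(`< m₀`) certificate at a point is an
  ABSENT certificate on the explicit box `|U' − U| + 2|μ' − μ| < 2h·m₀ − (hi₀ − lo)`
  (`dWaveOrderParameterTT'_lt_of_windows_near`).

READING. PRESENT never transports by perturbation: u.s.c. is the most the order parameter has (it is NOT lower
semicontinuous in general — order may appear discontinuously, first-order lines), so a floor `m⋆ ≥ m₀` certified
on any set extends only to its closure, and a certificate stable under perturbation of the couplings floors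
`m⋆` on an open cell only if the floor already holds on the cell's closure; ABSENT / `≤ x` cells DO transport,
with the computable radius of §3. HONEST SCOPE: topology and bookkeeping of the order parameter as a function of
the couplings; a CEILING tool on the ABSENT side; nothing here floors `d`-wave order anywhere.

## References
* R. T. Rockafellar, *Convex Analysis* (1970), Thm. 24.5 and Cor. 24.5.1 (`f'(x; y)` is an upper
  semicontinuous function of `(x, y)` on `int(dom f) × ℝⁿ`), Thm. 10.1 (finite convex functions on open sets
  are continuous). [cite: Rockafellar1970, Cor. 24.5.1]
* R. B. Israel, *Convexity in the Theory of Lattice Gases* (1979), Thm. I.3.4 (concavity and Lipschitz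
  continuity of the thermodynamic functional in the interaction). [cite: Israel1979, Thm. I.3.4]
* T. Koma, H. Tasaki, J. Stat. Phys. 76 (1994) 745–803, §1 (the quasi-average order parameter
  `lim_{h↓0} lim_Λ`). [cite: KomaTasaki1994, §1]
-/

noncomputable section

namespace Literature.MathematicalPhysics.QuantumLattice

open _root_.Filter Set Literature.Probability.LatticeModels HubbardWave0
open scoped _root_.Topology

/-! ### §1 Joint continuity of the sourced energy density in all couplings -/

/-- **`e_src` is locally Lipschitz on the coupling space `ℝ⁴ = {(t', U, μ, h)}`**: a finite concave function
on the open convex set `univ` of a finite-dimensional space. [cite: Rockafellar1970, Thm. 10.1] -/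
theorem locallyLipschitz_dWaveSourceEnergyDensityTT'_couplings :
    LocallyLipschitz fun c : ℝ × ℝ × ℝ × ℝ => dWaveSourceEnergyDensityTT' c.1 c.2.1 c.2.2.1 c.2.2.2 :=
  concaveOn_dWaveSourceEnergyDensityTT'_couplings.locallyLipschitz

/-- **`e_src(t', U, μ, h)` is JOINTLY CONTINUOUS in `(t', U, μ, h) ∈ ℝ⁴`.** [cite: Rockafellar1970, Thm. 10.1] -/
theorem continuous_dWaveSourceEnergyDensityTT'_couplings :
    Continuous fun c : ℝ × ℝ × ℝ × ℝ => dWaveSourceEnergyDensityTT' c.1 c.2.1 c.2.2.1 c.2.2.2 :=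
  locallyLipschitz_dWaveSourceEnergyDensityTT'_couplings.continuous

/-- Joint continuity in the three couplings `(t', U, μ)` at a fixed source `h`. [cite: Rockafellar1970, Thm. 10.1] -/
theorem continuous_dWaveSourceEnergyDensityTT'_couplings_at (h : ℝ) :
    Continuous fun c : ℝ × ℝ × ℝ => dWaveSourceEnergyDensityTT' c.1 c.2.1 c.2.2 h := by
  have hg : Continuous fun c : ℝ × ℝ × ℝ => ((c.1, c.2.1, c.2.2, h) : ℝ × ℝ × ℝ × ℝ) := by fun_prop
  have key := continuous_dWaveSourceEnergyDensityTT'_couplings.comp hg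
  simpa only [Function.comp_def] using key

/-- Continuity in the next-nearest-neighbour hopping `t'` (fixed `U, μ, h`). [cite: Israel1979, Thm. I.3.4] -/
theorem continuous_dWaveSourceEnergyDensityTT'_tp (U μ h : ℝ) :
    Continuous fun t' : ℝ => dWaveSourceEnergyDensityTT' t' U μ h := by
  have hg : Continuous fun t' : ℝ => ((t', U, μ, h) : ℝ × ℝ × ℝ × ℝ) := by fun_prop
  have key := continuous_dWaveSourceEnergyDensityTT'_couplings.comp hg
  simpa only [Function.comp_def] using key

/-- Continuity in the repulsion `U` (fixed `t', μ, h`). [cite: Israel1979, Thm. I.3.4] -/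
theorem continuous_dWaveSourceEnergyDensityTT'_U (t' μ h : ℝ) :
    Continuous fun U : ℝ => dWaveSourceEnergyDensityTT' t' U μ h := by
  have hg : Continuous fun U : ℝ => ((t', U, μ, h) : ℝ × ℝ × ℝ × ℝ) := by fun_prop
  have key := continuous_dWaveSourceEnergyDensityTT'_couplings.comp hg
  simpa only [Function.comp_def] using key

/-- Continuity in the chemical potential `μ` (fixed `t', U, h`). [cite: Israel1979, Thm. I.3.4] -/
theorem continuous_dWaveSourceEnergyDensityTT'_mu (t' U h : ℝ) :
    Continuous fun μ : ℝ => dWaveSourceEnergyDensityTT' t' U μ h := by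
  have hg : Continuous fun μ : ℝ => ((t', U, μ, h) : ℝ × ℝ × ℝ × ℝ) := by fun_prop
  have key := continuous_dWaveSourceEnergyDensityTT'_couplings.comp hg
  simpa only [Function.comp_def] using key

/-- Continuity in the source `h` (fixed `t', U, μ`). [cite: KomaTasaki1994, §1] -/
theorem continuous_dWaveSourceEnergyDensityTT'_source (t' U μ : ℝ) :
    Continuous fun h : ℝ => dWaveSourceEnergyDensityTT' t' U μ h := by
  have hg : Continuous fun h : ℝ => ((t', U, μ, h) : ℝ × ℝ × ℝ × ℝ) := by fun_prop
  have key := continuous_dWaveSourceEnergyDensityTT'_couplings.comp hg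
  simpa only [Function.comp_def] using key

/-- The `t' = 0` slice: `(U, μ, h) ↦ dWaveSourceEnergyDensity U μ h` is jointly concave on `ℝ³` (the Prop
`JointConcavity` (S2) of the crux sketch `FixedPointDWaveOrder/SketchIdeator1`, for the tree's `e_src`).
[cite: Israel1979, Thm. I.3.4] -/
theorem concaveOn_dWaveSourceEnergyDensity_couplings :
    ConcaveOn ℝ Set.univ fun p : ℝ × ℝ × ℝ => dWaveSourceEnergyDensity p.1 p.2.1 p.2.2 := by
  refine ⟨convex_univ, fun x _ y _ p q hp hq hpq => ?_⟩
  simp only [smul_eq_mul, Prod.smul_fst, Prod.smul_snd, Prod.fst_add, Prod.snd_add]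
  have key := dWaveSourceEnergyDensityTT'_convexComb_couplings_ge (tp₁ := 0) (U₁ := x.1) (μ₁ := x.2.1)
    (h₁ := x.2.2) (tp₂ := 0) (U₂ := y.1) (μ₂ := y.2.1) (h₂ := y.2.2) hp hq hpq
  have e0 : p * (0 : ℝ) + q * 0 = 0 := by ring
  rw [e0] at key
  simpa only [dWaveSourceEnergyDensityTT'_zero_tp] using key

/-- The `t' = 0` slice is jointly continuous in `(U, μ, h)`. [cite: Rockafellar1970, Thm. 10.1] -/
theorem continuous_dWaveSourceEnergyDensity_couplings :
    Continuous fun p : ℝ × ℝ × ℝ => dWaveSourceEnergyDensity p.1 p.2.1 p.2.2 := by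
  have hg : Continuous fun p : ℝ × ℝ × ℝ => (((0 : ℝ), p.1, p.2.1, p.2.2) : ℝ × ℝ × ℝ × ℝ) := by fun_prop
  have := continuous_dWaveSourceEnergyDensityTT'_couplings.comp hg
  simpa only [Function.comp_def, dWaveSourceEnergyDensityTT'_zero_tp] using this

/-! ### §2 Upper semicontinuity of the order parameter in the couplings -/

/-- The secant functional `(t',U,μ) ↦ (e_src(t',U,μ,0) − e_src(t',U,μ,h))/(2h)` is continuous for every `h`.
[cite: Rockafellar1970, Thm. 10.1] -/
theorem continuous_slope_dWaveSourceEnergyDensityTT'_couplings (h : ℝ) :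
    Continuous fun c : ℝ × ℝ × ℝ =>
      (dWaveSourceEnergyDensityTT' c.1 c.2.1 c.2.2 0 - dWaveSourceEnergyDensityTT' c.1 c.2.1 c.2.2 h) / (2 * h) :=
  ((continuous_dWaveSourceEnergyDensityTT'_couplings_at 0).sub
    (continuous_dWaveSourceEnergyDensityTT'_couplings_at h)).div_const _

/-- The secants are non-negative for `h > 0` (the source never raises the energy density). [cite: KomaTasaki1994, §1] -/
theorem slope_dWaveSourceEnergyDensityTT'_nonneg (t' U μ : ℝ) {h : ℝ} (hh : 0 < h) :
    0 ≤ (dWaveSourceEnergyDensityTT' t' U μ 0 - dWaveSourceEnergyDensityTT' t' U μ h) / (2 * h) :=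
  div_nonneg (sub_nonneg.2 (dWaveSourceEnergyDensityTT'_le_at_zero t' U μ h)) (by positivity)

/-- The cusp identity as an identity of functions on the coupling space:
`m⋆ = ⨅_{h>0} (e_src(·,0) − e_src(·,h))/(2h)`. [cite: KomaTasaki1994, §1] -/
theorem dWaveOrderParameterTT'_couplings_eq_iInf_slope :
    (fun c : ℝ × ℝ × ℝ => dWaveOrderParameterTT' c.1 c.2.1 c.2.2) = fun c =>
      ⨅ h : Set.Ioi (0 : ℝ), (dWaveSourceEnergyDensityTT' c.1 c.2.1 c.2.2 0 -
        dWaveSourceEnergyDensityTT' c.1 c.2.1 c.2.2 h) / (2 * (h : ℝ)) :=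
  funext fun c => dWaveOrderParameterTT'_eq_iInf_slope_energyDensity c.1 c.2.1 c.2.2

/-- **ORDER IS UPPER SEMICONTINUOUS IN THE COUPLINGS**: `(t', U, μ) ↦ dWaveOrderParameterTT' t' U μ` is upper
semicontinuous on `ℝ³` — an infimum over `h > 0` of continuous functions of the couplings (Rockafellar's
Cor. 24.5.1 for the convex `−e_src` on `ℝ⁴`, direction `e_h`, at the points `(t',U,μ,0)`).
[cite: Rockafellar1970, Cor. 24.5.1] -/
theorem upperSemicontinuous_dWaveOrderParameterTT' :
    UpperSemicontinuous fun c : ℝ × ℝ × ℝ => dWaveOrderParameterTT' c.1 c.2.1 c.2.2 := by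
  rw [dWaveOrderParameterTT'_couplings_eq_iInf_slope]
  refine upperSemicontinuous_ciInf
    (f := fun (h : Set.Ioi (0 : ℝ)) (c : ℝ × ℝ × ℝ) =>
      (dWaveSourceEnergyDensityTT' c.1 c.2.1 c.2.2 0 - dWaveSourceEnergyDensityTT' c.1 c.2.1 c.2.2 h) /
        (2 * (h : ℝ))) (fun c => ?_) (fun h => ?_)
  · refine ⟨0, ?_⟩
    rintro x ⟨h, rfl⟩
    exact slope_dWaveSourceEnergyDensityTT'_nonneg c.1 c.2.1 c.2.2 h.2
  · exact (continuous_slope_dWaveSourceEnergyDensityTT'_couplings (h : ℝ)).upperSemicontinuous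

/-- Upper semicontinuity at a point, spelled out: if `m⋆(t'₀,U₀,μ₀) < y` then `m⋆ < y` on a whole
neighbourhood of `(t'₀, U₀, μ₀)` — ABSENCE IS OPEN. [cite: Rockafellar1970, Cor. 24.5.1] -/
theorem eventually_dWaveOrderParameterTT'_lt {t'₀ U₀ μ₀ y : ℝ} (hy : dWaveOrderParameterTT' t'₀ U₀ μ₀ < y) :
    ∀ᶠ c in 𝓝 ((t'₀, U₀, μ₀) : ℝ × ℝ × ℝ), dWaveOrderParameterTT' c.1 c.2.1 c.2.2 < y :=
  upperSemicontinuous_dWaveOrderParameterTT' (t'₀, U₀, μ₀) y hy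

/-- **PRESENT cells are CLOSED**: `{(t',U,μ) : m₀ ≤ m⋆(t',U,μ)}` is a closed subset of `ℝ³`, every `m₀`.
[cite: Rockafellar1970, Cor. 24.5.1] -/
theorem isClosed_setOf_le_dWaveOrderParameterTT' (m₀ : ℝ) :
    IsClosed {c : ℝ × ℝ × ℝ | m₀ ≤ dWaveOrderParameterTT' c.1 c.2.1 c.2.2} :=
  upperSemicontinuous_dWaveOrderParameterTT'.isClosed_preimage m₀

/-- **ABSENT cells are OPEN**: `{(t',U,μ) : m⋆(t',U,μ) < m₀}` is an open subset of `ℝ³`, every `m₀`.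
[cite: Rockafellar1970, Cor. 24.5.1] -/
theorem isOpen_setOf_dWaveOrderParameterTT'_lt (m₀ : ℝ) :
    IsOpen {c : ℝ × ℝ × ℝ | dWaveOrderParameterTT' c.1 c.2.1 c.2.2 < m₀} :=
  upperSemicontinuous_dWaveOrderParameterTT'.isOpen_preimage m₀

/-- The orderless region is a countable intersection of open ABSENT cells:
`{¬ HasDWaveOrderTT'} = ⋂ₙ {m⋆ < 1/(n+1)}` (`m⋆ ≥ 0`). [cite: KomaTasaki1994, §1] -/
theorem setOf_not_hasDWaveOrderTT'_eq_iInter :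
    {c : ℝ × ℝ × ℝ | ¬ HasDWaveOrderTT' c.1 c.2.1 c.2.2} =
      ⋂ n : ℕ, {c : ℝ × ℝ × ℝ | dWaveOrderParameterTT' c.1 c.2.1 c.2.2 < 1 / ((n : ℝ) + 1)} := by
  ext c
  simp only [HasDWaveOrderTT', not_lt, Set.mem_setOf_eq, Set.mem_iInter]
  constructor
  · intro hc n
    exact lt_of_le_of_lt hc (by positivity)
  · intro hc
    refine le_of_forall_gt_imp_ge_of_dense fun y hy => ?_
    obtain ⟨n, hn⟩ := exists_nat_one_div_lt hy
    exact ((hc n).trans hn).le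

/-- **The orderless region `{(t',U,μ) : ¬ HasDWaveOrderTT'}` is a `G_δ` subset of `ℝ³`.**
[cite: Rockafellar1970, Cor. 24.5.1] -/
theorem isGδ_setOf_not_hasDWaveOrderTT' :
    IsGδ {c : ℝ × ℝ × ℝ | ¬ HasDWaveOrderTT' c.1 c.2.1 c.2.2} := by
  rw [setOf_not_hasDWaveOrderTT'_eq_iInter]
  exact IsGδ.iInter_of_isOpen fun n => isOpen_setOf_dWaveOrderParameterTT'_lt _

/-- The ordered region is a countable union of closed PRESENT cells: `{HasDWaveOrderTT'} = ⋃ₙ {1/(n+1) ≤ m⋆}`.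
[cite: KomaTasaki1994, §1] -/
theorem setOf_hasDWaveOrderTT'_eq_iUnion :
    {c : ℝ × ℝ × ℝ | HasDWaveOrderTT' c.1 c.2.1 c.2.2} =
      ⋃ n : ℕ, {c : ℝ × ℝ × ℝ | 1 / ((n : ℝ) + 1) ≤ dWaveOrderParameterTT' c.1 c.2.1 c.2.2} := by
  ext c
  simp only [HasDWaveOrderTT', Set.mem_setOf_eq, Set.mem_iUnion]
  constructor
  · intro hc
    obtain ⟨n, hn⟩ := exists_nat_one_div_lt hc
    exact ⟨n, hn.le⟩
  · rintro ⟨n, hn⟩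
    exact lt_of_lt_of_le (by positivity) hn

/-- **PRESENT passes to limits of couplings carrying a UNIFORM floor**: if `(t'ᵢ, Uᵢ, μᵢ) → (t'₀, U₀, μ₀)`
along a non-trivial filter and eventually `m₀ ≤ m⋆(t'ᵢ,Uᵢ,μᵢ)`, then `m₀ ≤ m⋆(t'₀,U₀,μ₀)`.
[cite: Rockafellar1970, Thm. 24.5] -/
theorem le_dWaveOrderParameterTT'_of_tendsto {ι : Type*} {l : Filter ι} [l.NeBot] {tp U μ : ι → ℝ}
    {tp₀ U₀ μ₀ m₀ : ℝ} (htp : Tendsto tp l (𝓝 tp₀)) (hU : Tendsto U l (𝓝 U₀)) (hμ : Tendsto μ l (𝓝 μ₀))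
    (hfloor : ∀ᶠ i in l, m₀ ≤ dWaveOrderParameterTT' (tp i) (U i) (μ i)) :
    m₀ ≤ dWaveOrderParameterTT' tp₀ U₀ μ₀ := by
  have hc : Tendsto (fun i => ((tp i, U i, μ i) : ℝ × ℝ × ℝ)) l (𝓝 (tp₀, U₀, μ₀)) :=
    htp.prodMk_nhds (hU.prodMk_nhds hμ)
  have hfloor' : ∀ᶠ i in l, ((tp i, U i, μ i) : ℝ × ℝ × ℝ) ∈
      {c : ℝ × ℝ × ℝ | m₀ ≤ dWaveOrderParameterTT' c.1 c.2.1 c.2.2} :=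
    hfloor.mono fun i hi => by simpa only [Set.mem_setOf_eq] using hi
  have key := (isClosed_setOf_le_dWaveOrderParameterTT' m₀).mem_of_tendsto hc hfloor'
  simpa only [Set.mem_setOf_eq] using key

/-- **The `limsup` form of upper semicontinuity along sequences of couplings**:
`limsup_n m⋆(t'ₙ,Uₙ,μₙ) ≤ m⋆(t'₀,U₀,μ₀)` whenever `(t'ₙ,Uₙ,μₙ) → (t'₀,U₀,μ₀)`. [cite: Rockafellar1970, Thm. 24.5] -/
theorem limsup_dWaveOrderParameterTT'_le_of_tendsto {tp U μ : ℕ → ℝ} {tp₀ U₀ μ₀ : ℝ}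
    (htp : Tendsto tp atTop (𝓝 tp₀)) (hU : Tendsto U atTop (𝓝 U₀)) (hμ : Tendsto μ atTop (𝓝 μ₀)) :
    limsup (fun n => dWaveOrderParameterTT' (tp n) (U n) (μ n)) atTop ≤ dWaveOrderParameterTT' tp₀ U₀ μ₀ := by
  have hc : Tendsto (fun n => ((tp n, U n, μ n) : ℝ × ℝ × ℝ)) atTop (𝓝 (tp₀, U₀, μ₀)) :=
    htp.prodMk_nhds (hU.prodMk_nhds hμ)
  have hcobdd : IsCoboundedUnder (· ≤ ·) atTop fun n => dWaveOrderParameterTT' (tp n) (U n) (μ n) :=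
    isCoboundedUnder_le_of_eventually_le atTop (x := 0)
      (Eventually.of_forall fun n => dWaveOrderParameterTT'_nonneg (tp n) (U n) (μ n))
  refine le_of_forall_gt_imp_ge_of_dense fun y hy => ?_
  have hev : ∀ᶠ n in atTop, dWaveOrderParameterTT' (tp n) (U n) (μ n) < y :=
    hc.eventually (eventually_dWaveOrderParameterTT'_lt hy)
  exact limsup_le_of_le hcobdd (hev.mono fun n hn => hn.le)

/-- **A uniform floor on a DENSE subset of an open coupling set holds on the whole set** (closedness of
PRESENT cells): `S` open, `D` dense, `m₀ ≤ m⋆` on `S ∩ D` ⇒ `m₀ ≤ m⋆` on `S`. [cite: Rockafellar1970, Cor. 24.5.1] -/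
theorem le_dWaveOrderParameterTT'_of_dense {S D : Set (ℝ × ℝ × ℝ)} (hS : IsOpen S) (hD : Dense D) {m₀ : ℝ}
    (hfloor : ∀ c ∈ S ∩ D, m₀ ≤ dWaveOrderParameterTT' c.1 c.2.1 c.2.2) :
    ∀ c ∈ S, m₀ ≤ dWaveOrderParameterTT' c.1 c.2.1 c.2.2 := by
  intro c hc
  have h1 : c ∈ closure (S ∩ D) := hD.open_subset_closure_inter hS hc
  have h2 : closure (S ∩ D) ⊆ {c : ℝ × ℝ × ℝ | m₀ ≤ dWaveOrderParameterTT' c.1 c.2.1 c.2.2} :=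
    closure_minimal (fun c hc => hfloor c hc) (isClosed_setOf_le_dWaveOrderParameterTT' m₀)
  exact h2 h1

/-- Upper semicontinuity in the chemical potential alone (fixed `t', U`). [cite: Rockafellar1970, Cor. 24.5.1] -/
theorem upperSemicontinuous_dWaveOrderParameterTT'_mu (t' U : ℝ) :
    UpperSemicontinuous fun μ : ℝ => dWaveOrderParameterTT' t' U μ := by
  have hg : Continuous fun μ : ℝ => ((t', U, μ) : ℝ × ℝ × ℝ) := by fun_prop
  have key := upperSemicontinuous_dWaveOrderParameterTT'.comp hg
  simpa only [Function.comp_def] using key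

/-- Upper semicontinuity in the repulsion alone (fixed `t', μ`). [cite: Rockafellar1970, Cor. 24.5.1] -/
theorem upperSemicontinuous_dWaveOrderParameterTT'_U (t' μ : ℝ) :
    UpperSemicontinuous fun U : ℝ => dWaveOrderParameterTT' t' U μ := by
  have hg : Continuous fun U : ℝ => ((t', U, μ) : ℝ × ℝ × ℝ) := by fun_prop
  have key := upperSemicontinuous_dWaveOrderParameterTT'.comp hg
  simpa only [Function.comp_def] using key

/-- Upper semicontinuity in the next-nearest-neighbour hopping alone (fixed `U, μ`). [cite: Rockafellar1970, Cor. 24.5.1] -/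
theorem upperSemicontinuous_dWaveOrderParameterTT'_tp (U μ : ℝ) :
    UpperSemicontinuous fun t' : ℝ => dWaveOrderParameterTT' t' U μ := by
  have hg : Continuous fun t' : ℝ => ((t', U, μ) : ℝ × ℝ × ℝ) := by fun_prop
  have key := upperSemicontinuous_dWaveOrderParameterTT'.comp hg
  simpa only [Function.comp_def] using key

/-- **A uniform floor on a dense set of chemical potentials in a window holds on the whole window** (fixed
`t', U`): `D ⊆ ℝ` dense, `m₀ ≤ m⋆(t',U,μ)` for `μ ∈ (a,b) ∩ D` ⇒ for all `μ ∈ (a,b)`. [cite: Rockafellar1970, Cor. 24.5.1] -/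
theorem le_dWaveOrderParameterTT'_of_dense_mu (t' U : ℝ) {a b m₀ : ℝ} {D : Set ℝ} (hD : Dense D)
    (hfloor : ∀ μ ∈ Set.Ioo a b ∩ D, m₀ ≤ dWaveOrderParameterTT' t' U μ) :
    ∀ μ ∈ Set.Ioo a b, m₀ ≤ dWaveOrderParameterTT' t' U μ := by
  intro μ hμ
  have h1 : μ ∈ closure (Set.Ioo a b ∩ D) := hD.open_subset_closure_inter isOpen_Ioo hμ
  have hcl : IsClosed {μ : ℝ | m₀ ≤ dWaveOrderParameterTT' t' U μ} :=
    (upperSemicontinuous_dWaveOrderParameterTT'_mu t' U).isClosed_preimage m₀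
  have h2 : closure (Set.Ioo a b ∩ D) ⊆ {μ : ℝ | m₀ ≤ dWaveOrderParameterTT' t' U μ} :=
    closure_minimal (fun μ hμ => hfloor μ hμ) hcl
  exact h2 h1

/-- **Order on a whole window of chemical potentials from a uniform floor on a dense subset** (fixed `t', U`):
`0 < m₀ ≤ m⋆` on `(a,b) ∩ D`, `D` dense ⇒ `HasDWaveOrderTT' t' U μ` for every `μ ∈ (a,b)`.
[cite: KomaTasaki1994, §1] -/
theorem hasDWaveOrderTT'_of_dense_mu (t' U : ℝ) {a b m₀ : ℝ} (hm₀ : 0 < m₀) {D : Set ℝ} (hD : Dense D)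
    (hfloor : ∀ μ ∈ Set.Ioo a b ∩ D, m₀ ≤ dWaveOrderParameterTT' t' U μ) :
    ∀ μ ∈ Set.Ioo a b, HasDWaveOrderTT' t' U μ :=
  fun μ hμ => lt_of_lt_of_le hm₀ (le_dWaveOrderParameterTT'_of_dense_mu t' U hD hfloor μ hμ)

/-! #### The `t' = 0` reading (`dWaveOrderParameter`, `HasDWaveOrder`) -/

/-- **`(U, μ) ↦ dWaveOrderParameter U μ` is upper semicontinuous on `ℝ²`** — literally the Prop
`OrderParameterUSC` (S4) posited in `Cruxes/FixedPointDWaveOrder/SketchIdeator1.lean`, now a theorem.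
[cite: Rockafellar1970, Cor. 24.5.1] -/
theorem upperSemicontinuous_dWaveOrderParameter :
    UpperSemicontinuous fun p : ℝ × ℝ => dWaveOrderParameter p.1 p.2 := by
  have hg : Continuous fun p : ℝ × ℝ => (((0 : ℝ), p.1, p.2) : ℝ × ℝ × ℝ) := by fun_prop
  have := upperSemicontinuous_dWaveOrderParameterTT'.comp hg
  simpa only [Function.comp_def, dWaveOrderParameterTT'_zero] using this

/-- PRESENT cells `{(U,μ) : m₀ ≤ dWaveOrderParameter U μ}` are closed in `ℝ²` (the sketch's `isClosed_orderFloor`,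
hypothesis discharged). [cite: Rockafellar1970, Cor. 24.5.1] -/
theorem isClosed_setOf_le_dWaveOrderParameter (m₀ : ℝ) :
    IsClosed {p : ℝ × ℝ | m₀ ≤ dWaveOrderParameter p.1 p.2} :=
  upperSemicontinuous_dWaveOrderParameter.isClosed_preimage m₀

/-- ABSENT cells `{(U,μ) : dWaveOrderParameter U μ < m₀}` are open in `ℝ²`. [cite: Rockafellar1970, Cor. 24.5.1] -/
theorem isOpen_setOf_dWaveOrderParameter_lt (m₀ : ℝ) :
    IsOpen {p : ℝ × ℝ | dWaveOrderParameter p.1 p.2 < m₀} :=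
  upperSemicontinuous_dWaveOrderParameter.isOpen_preimage m₀

/-- Upper semicontinuity of `μ ↦ dWaveOrderParameter U μ` (fixed `U`). [cite: Rockafellar1970, Cor. 24.5.1] -/
theorem upperSemicontinuous_dWaveOrderParameter_mu (U : ℝ) :
    UpperSemicontinuous fun μ : ℝ => dWaveOrderParameter U μ := by
  simpa only [dWaveOrderParameterTT'_zero] using upperSemicontinuous_dWaveOrderParameterTT'_mu 0 U

/-- **Order on a DENSE subset of a window of chemical potentials with a UNIFORM floor extends to the whole
window** — `order_of_dense_uniform` of the sketch `FixedPointDWaveOrder/SketchIdeator1`, with its hypothesis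
`OrderParameterUSC` discharged. [cite: KomaTasaki1994, §1] -/
theorem hasDWaveOrder_of_dense_uniform {U a b c : ℝ} (hc : 0 < c) {D : Set ℝ} (hD : Dense D)
    (hfloor : ∀ μ ∈ D ∩ Set.Ioo a b, c ≤ dWaveOrderParameter U μ) :
    ∀ μ ∈ Set.Ioo a b, HasDWaveOrder U μ := by
  intro μ hμ
  have key := hasDWaveOrderTT'_of_dense_mu 0 U hc hD (a := a) (b := b)
    (fun ν hν => by simpa only [dWaveOrderParameterTT'_zero] using hfloor ν ⟨hν.2, hν.1⟩) μ hμ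
  exact (hasDWaveOrderTT'_zero_iff U μ).1 key

/-! ### §3 Quantitative ABSENT transport across the couplings `(U, μ)` (the box-cell format) -/

section Transport

variable (t' : ℝ)

/-- **The secant numerator moves by at most `|U' − U|` in the repulsion** (any two sources `h₀, h`):
`[e_src(U',h₀) − e_src(U',h)] − [e_src(U,h₀) − e_src(U,h)] ≤ |U' − U|` — ONE of the two terms moves for free by
monotonicity in `U`, the other by the `1`-Lipschitz bound. [cite: Israel1979, Thm. I.3.4] -/
theorem secant_dWaveSourceEnergyDensityTT'_sub_U_le (μ h₀ h U U' : ℝ) :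
    (dWaveSourceEnergyDensityTT' t' U' μ h₀ - dWaveSourceEnergyDensityTT' t' U' μ h) -
      (dWaveSourceEnergyDensityTT' t' U μ h₀ - dWaveSourceEnergyDensityTT' t' U μ h) ≤ |U' - U| := by
  rcases le_total U U' with hle | hle
  · have h1 := dWaveSourceEnergyDensityTT'_le_add_sub_U t' μ h₀ hle
    have h2 := dWaveSourceEnergyDensityTT'_mono_U t' μ h hle
    rw [abs_of_nonneg (sub_nonneg.2 hle)]
    linarith
  · have h1 := dWaveSourceEnergyDensityTT'_mono_U t' μ h₀ hle
    have h2 := dWaveSourceEnergyDensityTT'_le_add_sub_U t' μ h hle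
    rw [abs_of_nonpos (sub_nonpos.2 hle)]
    linarith

/-- **The secant numerator moves by at most `2|μ' − μ|` in the chemical potential** (any two sources
`h₀, h`). [cite: Israel1979, Thm. I.3.4] -/
theorem secant_dWaveSourceEnergyDensityTT'_sub_mu_le (U h₀ h μ μ' : ℝ) :
    (dWaveSourceEnergyDensityTT' t' U μ' h₀ - dWaveSourceEnergyDensityTT' t' U μ' h) -
      (dWaveSourceEnergyDensityTT' t' U μ h₀ - dWaveSourceEnergyDensityTT' t' U μ h) ≤ 2 * |μ' - μ| := by
  rcases le_total μ μ' with hle | hle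
  · have h1 := dWaveSourceEnergyDensityTT'_antitone_mu t' U h₀ hle
    have h2 := dWaveSourceEnergyDensityTT'_le_add_two_mul t' U h hle
    rw [abs_of_nonneg (sub_nonneg.2 hle)]
    linarith
  · have h1 := dWaveSourceEnergyDensityTT'_le_add_two_mul t' U h₀ hle
    have h2 := dWaveSourceEnergyDensityTT'_antitone_mu t' U h hle
    rw [abs_of_nonpos (sub_nonpos.2 hle)]
    linarith

/-- **The secant at `(U', μ')` exceeds the secant at `(U, μ)` by at most `(|U' − U| + 2|μ' − μ|)/(2h)`**
(`h > 0`). [cite: Israel1979, Thm. I.3.4] -/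
theorem slope_dWaveSourceEnergyDensityTT'_le_slope_add (U μ U' μ' : ℝ) {h : ℝ} (hh : 0 < h) :
    (dWaveSourceEnergyDensityTT' t' U' μ' 0 - dWaveSourceEnergyDensityTT' t' U' μ' h) / (2 * h) ≤
      (dWaveSourceEnergyDensityTT' t' U μ 0 - dWaveSourceEnergyDensityTT' t' U μ h) / (2 * h) +
        (|U' - U| + 2 * |μ' - μ|) / (2 * h) := by
  have h1 := secant_dWaveSourceEnergyDensityTT'_sub_U_le t' μ' 0 h U U'
  have h2 := secant_dWaveSourceEnergyDensityTT'_sub_mu_le t' U 0 h μ μ'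
  rw [← add_div]
  exact div_le_div_of_nonneg_right (by linarith) (by positivity)

/-- **Quantitative upper semicontinuity**: for every `h > 0` and all couplings,
`m⋆(t',U',μ') ≤ (e_src(t',U,μ,0) − e_src(t',U,μ,h) + |U' − U| + 2|μ' − μ|)/(2h)`. [cite: Rockafellar1970, Thm. 24.5] -/
theorem dWaveOrderParameterTT'_le_slope_add_of_couplings (U μ U' μ' : ℝ) {h : ℝ} (hh : 0 < h) :
    dWaveOrderParameterTT' t' U' μ' ≤
      (dWaveSourceEnergyDensityTT' t' U μ 0 - dWaveSourceEnergyDensityTT' t' U μ h + |U' - U| + 2 * |μ' - μ|) /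
        (2 * h) := by
  have h1 := dWaveOrderParameterTT'_le_slope_energyDensity t' U' μ' hh
  have h2 := slope_dWaveSourceEnergyDensityTT'_le_slope_add t' U μ U' μ' hh
  rw [← add_div] at h2
  have h3 : dWaveSourceEnergyDensityTT' t' U μ 0 - dWaveSourceEnergyDensityTT' t' U μ h + (|U' - U| + 2 * |μ' - μ|) =
      dWaveSourceEnergyDensityTT' t' U μ 0 - dWaveSourceEnergyDensityTT' t' U μ h + |U' - U| + 2 * |μ' - μ| := by
    ring
  rw [h3] at h2
  exact h1.trans h2

/-- **THE BOX-CELL CEILING from one certified coupling point**: a certified UPPER bound `e_src(t',U,μ,0) ≤ hi₀`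
on the source-free energy density and a certified LOWER bound `lo ≤ e_src(t',U,μ,h)` at ONE source `h > 0`,
both at the coupling point `(t', U, μ)`, give on the WHOLE `(U', μ')`-plane
`m⋆(t',U',μ') ≤ (hi₀ − lo + |U' − U| + 2|μ' − μ|)/(2h)`. (A ceiling; ABSENT side only.) [cite: Israel1979, Thm. I.3.4] -/
theorem dWaveOrderParameterTT'_le_of_windows_couplings {U μ h hi₀ lo : ℝ} (hh : 0 < h)
    (hhi : dWaveSourceEnergyDensityTT' t' U μ 0 ≤ hi₀) (hlo : lo ≤ dWaveSourceEnergyDensityTT' t' U μ h)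
    (U' μ' : ℝ) :
    dWaveOrderParameterTT' t' U' μ' ≤ (hi₀ - lo + |U' - U| + 2 * |μ' - μ|) / (2 * h) := by
  refine (dWaveOrderParameterTT'_le_slope_add_of_couplings t' U μ U' μ' hh).trans ?_
  exact div_le_div_of_nonneg_right (by linarith) (by positivity)

/-- The `μ`-box form at fixed `(t', U)`: `|μ' − μ| ≤ r ⇒ m⋆(t',U,μ') ≤ (hi₀ − lo + 2r)/(2h)`.
[cite: Israel1979, Thm. I.3.4] -/
theorem dWaveOrderParameterTT'_le_of_windows_mu_box {U μ h hi₀ lo r : ℝ} (hh : 0 < h)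
    (hhi : dWaveSourceEnergyDensityTT' t' U μ 0 ≤ hi₀) (hlo : lo ≤ dWaveSourceEnergyDensityTT' t' U μ h)
    {μ' : ℝ} (hr : |μ' - μ| ≤ r) :
    dWaveOrderParameterTT' t' U μ' ≤ (hi₀ - lo + 2 * r) / (2 * h) := by
  have key := dWaveOrderParameterTT'_le_of_windows_couplings t' hh hhi hlo U μ'
  rw [sub_self, abs_zero, add_zero] at key
  exact key.trans (div_le_div_of_nonneg_right (by linarith) (by positivity))

/-- The `U`-box form at fixed `(t', μ)`: `|U' − U| ≤ r ⇒ m⋆(t',U',μ) ≤ (hi₀ − lo + r)/(2h)`.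
[cite: Israel1979, Thm. I.3.4] -/
theorem dWaveOrderParameterTT'_le_of_windows_U_box {U μ h hi₀ lo r : ℝ} (hh : 0 < h)
    (hhi : dWaveSourceEnergyDensityTT' t' U μ 0 ≤ hi₀) (hlo : lo ≤ dWaveSourceEnergyDensityTT' t' U μ h)
    {U' : ℝ} (hr : |U' - U| ≤ r) :
    dWaveOrderParameterTT' t' U' μ ≤ (hi₀ - lo + r) / (2 * h) := by
  have key := dWaveOrderParameterTT'_le_of_windows_couplings t' hh hhi hlo U' μ
  rw [sub_self, abs_zero, mul_zero, add_zero] at key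
  exact key.trans (div_le_div_of_nonneg_right (by linarith) (by positivity))

/-- **An ABSENT(`< m₀`) certificate at a point is an ABSENT certificate on an explicit box**: if
`hi₀ − lo < 2h·m₀` then `m⋆(t',U',μ') < m₀` whenever `|U' − U| + 2|μ' − μ| < 2h·m₀ − (hi₀ − lo)`.
[cite: Israel1979, Thm. I.3.4] -/
theorem dWaveOrderParameterTT'_lt_of_windows_near {U μ h hi₀ lo m₀ : ℝ} (hh : 0 < h)
    (hhi : dWaveSourceEnergyDensityTT' t' U μ 0 ≤ hi₀) (hlo : lo ≤ dWaveSourceEnergyDensityTT' t' U μ h)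
    {U' μ' : ℝ} (hnear : |U' - U| + 2 * |μ' - μ| < 2 * h * m₀ - (hi₀ - lo)) :
    dWaveOrderParameterTT' t' U' μ' < m₀ := by
  refine lt_of_le_of_lt (dWaveOrderParameterTT'_le_of_windows_couplings t' hh hhi hlo U' μ') ?_
  rw [div_lt_iff₀ (by positivity)]
  linarith

/-- In particular no `d`-wave order anywhere on that box when `m₀` is taken arbitrarily small: if
`hi₀ − lo < 2h·m₀` and `|U' − U| + 2|μ' − μ| < 2h·m₀ − (hi₀ − lo)` then `m⋆(t',U',μ') < m₀`; with the
pinning-field reading `HasDWaveOrderTT' ↔ 0 < m⋆` this is the shape «`≤ x` on a box» of a phase-map cell.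
The zero-slack corner: `hi₀ = lo` forces `m⋆ = 0` at the point itself. [cite: KomaTasaki1994, §1] -/
theorem not_hasDWaveOrderTT'_of_windows_eq {U μ h v : ℝ} (hh : 0 < h)
    (hhi : dWaveSourceEnergyDensityTT' t' U μ 0 ≤ v) (hlo : v ≤ dWaveSourceEnergyDensityTT' t' U μ h) :
    ¬ HasDWaveOrderTT' t' U μ := by
  have key := dWaveOrderParameterTT'_le_of_windows_couplings t' hh hhi hlo U μ
  rw [sub_self, sub_self, sub_self, abs_zero, mul_zero, add_zero, add_zero, zero_div] at key
  exact not_lt.2 key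

end Transport

end Literature.MathematicalPhysics.QuantumLattice
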